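import Summits.CriticalPhenomena.PercolationContinuityZ3.Theorems.PercShatteringRaceRaceLemma
import HarnessLib

/-!
# Crux `PercShatteringRace.NearLinearTwoClusterDecay` (stmt-CriticalPhenomena-5785) — what the route CONSUMES of `U`: the jump form

Helper file of the lead (seat c3) of the line `critical-orange-peeling`; lands with
`--supports stmt-CriticalPhenomena-5785` (registered stubs `raceLemma_jump`,
`percolationContinuityZ3_of_powerSaving_of_jumpTwoClusterDecay`, `nearLinearTwoClusterDecay_iff_worlds`).

The crux `U(1/6) = NearLinearTwoClusterDecay` is filed UNCONDITIONALLY: two-cluster decay at aspect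
`n^{7/6}` for critical bond percolation on `ℤ³`.  Logically `U ↔ U⁰ ∧ U′` with
`U′ := (0 < θ(p_c) → U)` (the jump world) and `U⁰ := (θ(p_c) = 0 → U)` (the orthodox world)
(`nearLinearTwoClusterDecay_iff_worlds`).  The route's deciding theorem
`Theses.PercShatteringRace.closes hS hU hR` uses `hU` only to contradict `θ(p_c) > 0` (proof of
`Theorems.raceLemma_proof`: `by_contra`, then `θ > 0`, then `U`), so the JUMP FORM `U′` already closes
the route: `raceLemma_jump` (all admissible exponents `(a, b)`) and
`percolationContinuityZ3_of_powerSaving_of_jumpTwoClusterDecay` (the filed instance `(1/2, 1/6)`).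
Consequently the conjunct `U⁰` — a hyperscaling-type statement at `p_c(ℤ³)` (false for `d ≥ 7`,
barrier `Literature.Barriers.CriticalPhenomena.SpanningClustersAboveSix`; no `d < 6` input is known) —
is never consumed by this route.  This certifies the restate recommendation of the crux memos
(`Cruxes/NearLinearTwoClusterDecay/Ideas/memo-5785-for-tenure.md`, `AtomCensus-ideator1-g2.md §1`).
No new mathematics: pure logic over the landed `raceLemma_proof`.
-/

noncomputable section

namespace Summit.CriticalPhenomena.PercolationContinuityZ3.Theorems.NearLinearTwoClusterDecay.Consumed

open MeasureTheory Filter Topology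
open Literature.Probability.LatticeModels Literature.Probability.Percolation
open Summit.CriticalPhenomena.PercolationContinuityZ3.Theses.PercShatteringRace

/-- **Jump form of the race lemma** (registered stub `raceLemma_jump`): for real `a, b` with
`0 < b`, `(1 + b)(3 - a) < 3`, the free-box power saving `S(a)` and the two-cluster decay `U(b)`
ASSUMED ONLY IN THE JUMP WORLD `θ(p_c) > 0` give `θ(p_c) = 0` on `ℤ³`.  Proof: if `θ(p_c) = 0` we
are done (`PercolationContinuityZ3` is literally `θ(p_c) = 0`); otherwise `θ(p_c) > 0`, the
hypothesis yields `U(b)`, and the landed `raceLemma_proof a b` applies. [folklore] -/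
theorem raceLemma_jump : ∀ a b : ℝ, 0 < b → (1 + b) * (3 - a) < 3 →
    (∃ C : ℝ, ∀ R : ℕ, 1 ≤ R → ∑ y ∈ box 3 R,
      (bondPercolation (zdGraph 3) (criticalProbI 3)).real (openConnIn (↑(box 3 R) : Set (Site 3)) 0 y)
        ≤ C * (R : ℝ) ^ (3 - a)) →
    (0 < theta (zdGraph 3) 0 (criticalProbI 3) →
      Tendsto (fun n : ℕ => (bondPercolation (zdGraph 3) (criticalProbI 3)).real
        {ω | ∃ x ∈ box 3 n, ∃ x' ∈ box 3 n, ∃ y ∈ innerBoundary (zdGraph 3) (box 3 ⌈(n : ℝ) ^ (1 + b)⌉₊),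
          ∃ y' ∈ innerBoundary (zdGraph 3) (box 3 ⌈(n : ℝ) ^ (1 + b)⌉₊),
            ω ∈ openConnIn (↑(box 3 ⌈(n : ℝ) ^ (1 + b)⌉₊) : Set (Site 3)) x y ∧
            ω ∈ openConnIn (↑(box 3 ⌈(n : ℝ) ^ (1 + b)⌉₊) : Set (Site 3)) x' y' ∧
            ω ∉ openConnIn (↑(box 3 ⌈(n : ℝ) ^ (1 + b)⌉₊) : Set (Site 3)) x x'}) atTop (𝓝 0)) →
    _root_.PercolationContinuityZ3 := by
  intro a b hb hab hS hUj
  by_cases hθ : theta (zdGraph 3) (0 : Site 3) (criticalProbI 3) = 0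
  · exact hθ
  · have hpos : 0 < theta (zdGraph 3) (0 : Site 3) (criticalProbI 3) :=
      lt_of_le_of_ne measureReal_nonneg (Ne.symm hθ)
    exact raceLemma_proof a b hb hab hS (hUj hpos)

/-- **The filed instance, jump form** (registered stub
`percolationContinuityZ3_of_powerSaving_of_jumpTwoClusterDecay`): `S(1/2) = FreeSusceptibilityPowerSaving`
together with the JUMP FORM `0 < θ(p_c) → U(1/6)` of the crux already gives `θ(p_c) = 0` on `ℤ³`
(`(1 + 1/6)(3 - 1/2) = 35/12 < 3`).  So the route never consumes the `θ(p_c) = 0`-world half of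
`NearLinearTwoClusterDecay`. [folklore] -/
theorem percolationContinuityZ3_of_powerSaving_of_jumpTwoClusterDecay :
    Summit.CriticalPhenomena.PercolationContinuityZ3.Theses.PercShatteringRace.FreeSusceptibilityPowerSaving →
    (0 < theta (zdGraph 3) 0 (criticalProbI 3) →
      Summit.CriticalPhenomena.PercolationContinuityZ3.Theses.PercShatteringRace.NearLinearTwoClusterDecay) →
    _root_.PercolationContinuityZ3 := by
  intro hS hUj
  have h := raceLemma_jump (1 / 2) (1 / 6) (by norm_num) (by norm_num)
  have e1 : (3 : ℝ) - 1 / 2 = 5 / 2 := by norm_num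
  have e2 : (1 : ℝ) + 1 / 6 = 7 / 6 := by norm_num
  rw [e1, e2] at h
  exact h hS hUj

/-- **`U ↔ U⁰ ∧ U′`** (registered stub `nearLinearTwoClusterDecay_iff_worlds`): the filed crux is the
conjunction of its orthodox-world half `θ(p_c) = 0 → U` and its jump-world half `0 < θ(p_c) → U`
(`θ ≥ 0` always, `measureReal_nonneg`).  Only the second half is consumed by the route
(`percolationContinuityZ3_of_powerSaving_of_jumpTwoClusterDecay`). [folklore] -/
theorem nearLinearTwoClusterDecay_iff_worlds :
    Summit.CriticalPhenomena.PercolationContinuityZ3.Theses.PercShatteringRace.NearLinearTwoClusterDecay ↔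
      ((theta (zdGraph 3) 0 (criticalProbI 3) = 0 →
          Summit.CriticalPhenomena.PercolationContinuityZ3.Theses.PercShatteringRace.NearLinearTwoClusterDecay) ∧
        (0 < theta (zdGraph 3) 0 (criticalProbI 3) →
          Summit.CriticalPhenomena.PercolationContinuityZ3.Theses.PercShatteringRace.NearLinearTwoClusterDecay)) := by
  refine ⟨fun h => ⟨fun _ => h, fun _ => h⟩, fun h => ?_⟩
  by_cases hθ : theta (zdGraph 3) (0 : Site 3) (criticalProbI 3) = 0
  · exact h.1 hθ
  · exact h.2 (lt_of_le_of_ne measureReal_nonneg (Ne.symm hθ))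

end Summit.CriticalPhenomena.PercolationContinuityZ3.Theorems.NearLinearTwoClusterDecay.Consumed
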